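import Summits.CriticalPhenomena.PercolationContinuityZ3.Theorems.PercNearOneGluingNoHeavyQuantCOCert
import HarnessLib

/-!
# QUANT lane R8, Conjecture DIB\* — `COCert ⟹ ∀ x < 1, DIBStar x` (part 2 of 2: the reduction)

builds on p205010 (kernel theorem, internal audit signed; external expert review pending)

Support file (`--supports stmt-CriticalPhenomena-4575`), QUANT lane typer seat prim-quant-stmt (gen 21); sequel of `…QuantCOCert`
(the `@[conjecture]` `COCert` and its two TERM rules).  Theorems only, no definitions, no sorries, standard axioms.

* **`Quant.RootDec.row_of_coCert : COCert →`** every normalised instance at a floor `1/2 < x < 7/8` (gates `≥ x²`, a largest blob `k₀` of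
  size `b ≤ j` with `j < 2x·b`, discounted credit `> 2j`) satisfies `x ≤ P(N ≥ j+1)`.  Proof: `term_cond` at `k₀`; `G` = the other blobs
  of size `≥ j − b + 1` (the giants relative to the sure part `b`), dust = the rest; `term_ge_of_or_cantelliDust` at the lower level,
  `term_ge_of_restMenu` at the upper level (`V_R ≤ b·s2_G + ℓ·s2_D`); the aggregates satisfy the constraints of `COCert` part by part
  (per-blob lemmas `phi_le_gate`, `gate_ge_floorSq_add`, `gate_var_le` of `…QuantOneBig`); `Q = ∏_G (1 − g)` obeys the two AM–GM bounds
  (`Literature.….Gurvits.finset_prod_le_arith_mean_pow` with `Σ_G g ≥ m_G/b` and `Σ_G g ≥ n x² + (1−x)C_G/b`).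
* **`Quant.IndepBlob.dibStar_of_coCert : COCert → ∀ x < 1, DIBStar x`** — floors `≤ 1/2` / `≥ 7/8` kernel (`dibStar_of_not_mem_Ioo`);
  on `(1/2, 7/8)`: junk lights zeroed, empty gates set to `1`, a giant of the normalised system certifies alone, `2x·b ≤ j` is granular
  (`tail_ge_of_granular`), otherwise `row_of_coCert`.  `stepLemmaFSMid_of_coCert`.
So **T-DIB (hence the R8 architecture's single probabilistic ingredient) follows from ONE explicit real inequality in nine variables**
(`COCert`; numerical margin 0.113 on its continuum relaxation, seat folder work/explore/agg4.py; exact census of the underlying certificate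
kit j133883: 21 323 residual instances / 0, min 0.237).
[this work]; the gluing rows served [cite: KozmaNitzan2024, Conjecture 3 (p. 15)]; product weights [cite: Grimmett1999, §1.3 p. 10].
-/

namespace Summit.CriticalPhenomena.PercolationContinuityZ3.Theorems

namespace Quant

open Finset

namespace RootDec

variable {κ : Type} [Fintype κ] [DecidableEq κ]

/-- product-Bernoulli weight of the set `W` of open blobs (as in `…QuantRootReduction`) -/
local notation3 "wt[" g ", " W "]" => ∏ k, (if k ∈ (W : Finset κ) then (g : κ → ℝ) k else 1 - (g : κ → ℝ) k)

/-- the TERM tail `P(s + Σ_{k open} a k ≥ j+1)` (as in `…QuantRootReduction`) -/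
local notation3 "TERM[" s ", " a ", " g ", " j "]" =>
  ∑ W : Finset κ, wt[g, W] * (if (j : ℕ) + 1 ≤ (s : ℕ) + ∑ k ∈ W, (a : κ → ℕ) k then (1 : ℝ) else 0)

/-- **T-DIB's mid-floor instances from `COCert`.**  Floor `1/2 < x < 7/8`, gates in `[x², 1]`, a largest blob `k₀` with `a k₀ ≤ j` and
`j < 2x·a k₀` (lumpy), discounted credit `> 2j` ⟹ `x ≤ P(N ≥ j+1)`.  Proof: `term_cond` at `k₀`; `G` = the other blobs of size
`≥ j − a k₀ + 1`, exact factorisation `one_sub_term_eq_giants` + Cantelli for the dust (`term_ge_of_cantelli`, `V_D ≤ ℓ·s2_D`); Cantelli /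
Markov for the whole rest at level `j` (`V_R ≤ b·s2_G + ℓ·s2_D`); the aggregates satisfy the constraints of `COCert` part by part
(per-blob lemmas of `…QuantOneBig`), `Q = ∏_G (1 − g)` its two AM–GM bounds. [this work] -/
theorem row_of_coCert (hC : IndepBlob.COCert) (a : κ → ℕ) (g : κ → ℝ) (j : ℕ) (x : ℝ) (hx : 1 / 2 < x) (hx78 : x < 7 / 8)
    (hg : ∀ i, 0 ≤ g i ∧ g i ≤ 1) (hfloor : ∀ i, x ^ 2 ≤ g i) (k₀ : κ) (hlargest : ∀ i, a i ≤ a k₀) (hkj : a k₀ ≤ j)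
    (hlumpy : (j : ℝ) < 2 * x * (a k₀ : ℝ))
    (hcredit : (2 * j : ℝ) < ∑ i, (a i : ℝ) * (if x ≤ g i then g i else (g i - x ^ 2) / (1 - x))) :
    x ≤ ∑ W : Finset κ, wt[g, W] * (if j + 1 ≤ ∑ i ∈ W, a i then (1 : ℝ) else 0) := by
  have hx0 : 0 ≤ x := by linarith
  have hx1 : x < 1 := by linarith
  have hy : 0 < 1 - x := by linarith
  set φ : κ → ℝ := fun i => if x ≤ g i then g i else (g i - x ^ 2) / (1 - x) with hφ
  set b : ℕ := a k₀ with hb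
  set a' : κ → ℕ := Function.update a k₀ 0 with ha'
  have ha'k : a' k₀ = 0 := by rw [ha', Function.update_self]
  have ha'ne : ∀ i, i ≠ k₀ → a' i = a i := fun i hi => by rw [ha', Function.update_of_ne hi]
  have ha'le : ∀ i, a' i ≤ b := by
    intro i; by_cases hi : i = k₀
    · rw [hi, ha'k]; exact Nat.zero_le _
    · rw [ha'ne i hi]; exact hlargest i
  -- the giants of the rest relative to the sure part `b`, and the dust
  set G : Finset κ := Finset.univ.filter (fun i => j + 1 ≤ b + a' i) with hGdef
  have hG : ∀ i ∈ G, j + 1 ≤ b + a' i := fun i hi => (Finset.mem_filter.1 hi).2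
  have hk₀G : k₀ ∉ G := by
    rw [hGdef, Finset.mem_filter, not_and, ha'k]; intro; omega
  set a'' : κ → ℕ := fun i => if i ∈ G then 0 else a' i with ha''
  have ha''le : ∀ i, a'' i ≤ j - b := by
    intro i; simp only [ha'']
    split_ifs with hi
    · exact Nat.zero_le _
    · have : ¬ (j + 1 ≤ b + a' i) := fun h => hi (Finset.mem_filter.2 ⟨Finset.mem_univ i, h⟩)
      omega
  have ha''G : ∀ i ∈ G, a'' i = 0 := fun i hi => by simp only [ha'', if_pos hi]
  have ha''nG : ∀ i, i ∉ G → a'' i = a' i := fun i hi => by simp only [ha'', if_neg hi]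
  -- the split at k₀
  have e := term_cond 0 a g j k₀
  simp only [zero_add] at e
  rw [e, show a k₀ = b from rfl, show Function.update a k₀ 0 = a' from rfl]
  -- real aggregates
  set AG : ℝ := ∑ i ∈ G, (a' i : ℝ) with hAG
  set mG : ℝ := ∑ i ∈ G, (a' i : ℝ) * g i with hmG
  set CG : ℝ := ∑ i ∈ G, (a' i : ℝ) * φ i with hCG
  set s2G : ℝ := ∑ i ∈ G, (a' i : ℝ) * g i * (1 - g i) with hs2G
  set AD : ℝ := ∑ i, (a'' i : ℝ) with hAD
  set mD : ℝ := ∑ i, (a'' i : ℝ) * g i with hmD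
  set CD : ℝ := ∑ i, (a'' i : ℝ) * φ i with hCD
  set s2D : ℝ := ∑ i, (a'' i : ℝ) * g i * (1 - g i) with hs2D
  set Q : ℝ := ∏ i ∈ G, (1 - g i) with hQ
  set n : ℕ := G.card with hn
  -- sums over `univ` of `a'` split as `G` + dust
  have hsplit : ∀ (f : κ → ℝ), ∑ i, (a' i : ℝ) * f i = ∑ i ∈ G, (a' i : ℝ) * f i + ∑ i, (a'' i : ℝ) * f i := by
    intro f
    rw [← Finset.sum_add_sum_compl G (fun i => (a' i : ℝ) * f i)]
    congr 1
    rw [← Finset.sum_add_sum_compl G (fun i => (a'' i : ℝ) * f i)]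
    have h1 : ∑ i ∈ G, (a'' i : ℝ) * f i = 0 := Finset.sum_eq_zero fun i hi => by rw [ha''G i hi, Nat.cast_zero, zero_mul]
    rw [h1, zero_add]
    exact Finset.sum_congr rfl fun i hi => by rw [ha''nG i (Finset.mem_compl.1 hi)]
  have hA_split : ∑ i, (a' i : ℝ) = AG + AD := by
    have := hsplit (fun _ => 1); simp only [mul_one] at this; rw [this]
  have hm_split : ∑ i, (a' i : ℝ) * g i = mG + mD := hsplit g
  have hC_split : ∑ i, (a' i : ℝ) * φ i = CG + CD := hsplit φ
  have hV_split : ∑ i, (a' i : ℝ) ^ 2 * g i * (1 - g i) ≤ (b : ℝ) * s2G + ((j - b : ℕ) : ℝ) * s2D := by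
    have e1 : ∑ i, (a' i : ℝ) ^ 2 * g i * (1 - g i) = ∑ i, (a' i : ℝ) * ((a' i : ℝ) * (g i * (1 - g i))) :=
      Finset.sum_congr rfl fun i _ => by ring
    rw [e1, hsplit (fun i => (a' i : ℝ) * (g i * (1 - g i))), hs2G, hs2D, Finset.mul_sum, Finset.mul_sum]
    refine add_le_add (Finset.sum_le_sum fun i _ => ?_) (Finset.sum_le_sum fun i _ => ?_)
    · have hgg : 0 ≤ g i * (1 - g i) := mul_nonneg (hg i).1 (sub_nonneg.2 (hg i).2)
      have h1 : (a' i : ℝ) ≤ b := by exact_mod_cast ha'le i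
      have : (a' i : ℝ) * ((a' i : ℝ) * (g i * (1 - g i))) ≤ (b : ℝ) * ((a' i : ℝ) * (g i * (1 - g i))) :=
        mul_le_mul_of_nonneg_right h1 (mul_nonneg (Nat.cast_nonneg _) hgg)
      calc (a' i : ℝ) * ((a' i : ℝ) * (g i * (1 - g i))) ≤ (b : ℝ) * ((a' i : ℝ) * (g i * (1 - g i))) := this
        _ = (b : ℝ) * ((a' i : ℝ) * g i * (1 - g i)) := by ring
    · have hgg : 0 ≤ g i * (1 - g i) := mul_nonneg (hg i).1 (sub_nonneg.2 (hg i).2)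
      by_cases hi : i ∈ G
      · rw [ha''G i hi]; simp
      · rw [ha''nG i hi]
        have h1 : (a' i : ℝ) ≤ ((j - b : ℕ) : ℝ) := by rw [← ha''nG i hi]; exact_mod_cast ha''le i
        have : (a' i : ℝ) * ((a' i : ℝ) * (g i * (1 - g i))) ≤ ((j - b : ℕ) : ℝ) * ((a' i : ℝ) * (g i * (1 - g i))) :=
          mul_le_mul_of_nonneg_right h1 (mul_nonneg (Nat.cast_nonneg _) hgg)
        calc (a' i : ℝ) * ((a' i : ℝ) * (g i * (1 - g i))) ≤ ((j - b : ℕ) : ℝ) * ((a' i : ℝ) * (g i * (1 - g i))) := this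
          _ = ((j - b : ℕ) : ℝ) * ((a' i : ℝ) * g i * (1 - g i)) := by ring
  -- per-blob facts for the rate `φ`
  have hφ0 : ∀ i, 0 ≤ φ i := fun i => by
    simp only [hφ]; exact IndepBlob.creditRate_nonneg x (g i) hx0 hx1 (hfloor i)
  have hφle : ∀ i, φ i ≤ g i := fun i => by
    simp only [hφ]; exact IndepBlob.phi_le_gate x (g i) hx0 hx1
  have hφsq : ∀ i, x ^ 2 + (1 - x) * φ i ≤ g i := fun i => by
    simp only [hφ]; exact IndepBlob.gate_ge_floorSq_add x (g i) hx0 hx1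
  have hφvar : ∀ i, g i * (1 - g i) ≤ (1 - x) * (2 * g i - φ i) := fun i => by
    simp only [hφ]; exact IndepBlob.gate_var_le x (g i) hx0 hx1
  -- aggregate constraints of a part
  have aux : ∀ (S : Finset κ) (c : κ → ℕ),
      0 ≤ ∑ i ∈ S, (c i : ℝ) * φ i ∧ ∑ i ∈ S, (c i : ℝ) * φ i ≤ ∑ i ∈ S, (c i : ℝ) * g i ∧
      x ^ 2 * (∑ i ∈ S, (c i : ℝ)) + (1 - x) * (∑ i ∈ S, (c i : ℝ) * φ i) ≤ ∑ i ∈ S, (c i : ℝ) * g i ∧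
      ∑ i ∈ S, (c i : ℝ) * g i ≤ ∑ i ∈ S, (c i : ℝ) ∧
      0 ≤ ∑ i ∈ S, (c i : ℝ) * g i * (1 - g i) ∧
      ∑ i ∈ S, (c i : ℝ) * g i * (1 - g i) ≤ (1 - x) * (2 * (∑ i ∈ S, (c i : ℝ) * g i) - ∑ i ∈ S, (c i : ℝ) * φ i) ∧
      ∑ i ∈ S, (c i : ℝ) * g i * (1 - g i) ≤ ∑ i ∈ S, (c i : ℝ) * g i ∧
      ∑ i ∈ S, (c i : ℝ) * g i * (1 - g i) ≤ (∑ i ∈ S, (c i : ℝ)) - ∑ i ∈ S, (c i : ℝ) * g i := by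
    intro S c
    have hc : ∀ i, (0 : ℝ) ≤ c i := fun i => Nat.cast_nonneg _
    refine ⟨?_, ?_, ?_, ?_, ?_, ?_, ?_, ?_⟩
    · exact Finset.sum_nonneg fun i _ => mul_nonneg (hc i) (hφ0 i)
    · exact Finset.sum_le_sum fun i _ => mul_le_mul_of_nonneg_left (hφle i) (hc i)
    · rw [Finset.mul_sum, Finset.mul_sum, ← Finset.sum_add_distrib]
      refine Finset.sum_le_sum fun i _ => ?_
      have h := mul_le_mul_of_nonneg_left (hφsq i) (hc i)
      have e : x ^ 2 * (c i : ℝ) + (1 - x) * ((c i : ℝ) * φ i) = (c i : ℝ) * (x ^ 2 + (1 - x) * φ i) := by ring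
      rw [e]; exact h
    · exact Finset.sum_le_sum fun i _ => by nlinarith [hc i, (hg i).2]
    · exact Finset.sum_nonneg fun i _ => by
        rw [mul_assoc]; exact mul_nonneg (hc i) (mul_nonneg (hg i).1 (sub_nonneg.2 (hg i).2))
    · rw [Finset.mul_sum, ← Finset.sum_sub_distrib, Finset.mul_sum]
      refine Finset.sum_le_sum fun i _ => ?_
      have h := mul_le_mul_of_nonneg_left (hφvar i) (hc i)
      have e1 : (c i : ℝ) * g i * (1 - g i) = (c i : ℝ) * (g i * (1 - g i)) := by ring
      have e2 : (1 - x) * (2 * ((c i : ℝ) * g i) - (c i : ℝ) * φ i) = (c i : ℝ) * ((1 - x) * (2 * g i - φ i)) := by ring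
      rw [e1, e2]; exact h
    · exact Finset.sum_le_sum fun i _ => by nlinarith [mul_nonneg (hc i) (hg i).1, (hg i).1, (hg i).2]
    · rw [← Finset.sum_sub_distrib]
      exact Finset.sum_le_sum fun i _ => by nlinarith [mul_nonneg (hc i) (sq_nonneg (1 - g i))]
  obtain ⟨hCG0, hCGm, hG2, hGmA, hs2G0, hs2G1, hs2G2, hs2G3⟩ := aux G a'
  obtain ⟨hCD0, hCDm, hD2, hDmA, hs2D0, hs2D1, hs2D2, hs2D3⟩ := aux Finset.univ a''
  -- G: count bounds
  have hAGlo : (n : ℝ) * (((j - b : ℕ) : ℝ) + 1) ≤ AG := by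
    have h1 : ∀ i ∈ G, (((j - b : ℕ) : ℝ) + 1) ≤ (a' i : ℝ) := by
      intro i hi; have := hG i hi
      have h2 : j - b + 1 ≤ a' i := by omega
      exact_mod_cast h2
    have := Finset.card_nsmul_le_sum G (fun i => (a' i : ℝ)) _ h1
    rw [nsmul_eq_mul] at this; rw [hn]; exact this
  have hAGhi : AG ≤ (n : ℝ) * b := by
    have := Finset.sum_le_card_nsmul G (fun i => (a' i : ℝ)) (b : ℝ) (fun i _ => by exact_mod_cast ha'le i)
    rw [nsmul_eq_mul] at this; rw [hn]; exact this
  -- Q bounds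
  have hQ0 : 0 ≤ Q := Finset.prod_nonneg fun i _ => sub_nonneg.2 (hg i).2
  have hQ1 : Q ≤ 1 := Finset.prod_le_one (fun i _ => sub_nonneg.2 (hg i).2) fun i _ => sub_le_self _ (hg i).1
  have hQn0 : n = 0 → Q = 1 := by
    intro h0; rw [hQ, Finset.card_eq_zero.1 (hn ▸ h0 : G.card = 0), Finset.prod_empty]
  have hsum_g_lo1 : mG ≤ (b : ℝ) * ∑ i ∈ G, g i := by
    rw [hmG, Finset.mul_sum]
    exact Finset.sum_le_sum fun i _ => mul_le_mul_of_nonneg_right (by exact_mod_cast ha'le i) (hg i).1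
  have hsum_g_lo2 : (n : ℝ) * x ^ 2 + (1 - x) * CG / b ≤ ∑ i ∈ G, g i ∨ b = 0 := by
    by_cases hb0 : b = 0
    · exact Or.inr hb0
    left
    have hbpos : (0 : ℝ) < b := by exact_mod_cast Nat.pos_of_ne_zero hb0
    have h1 : CG ≤ (b : ℝ) * ∑ i ∈ G, φ i := by
      rw [hCG, Finset.mul_sum]
      exact Finset.sum_le_sum fun i _ => mul_le_mul_of_nonneg_right (by exact_mod_cast ha'le i) (hφ0 i)
    have h2 : ∑ i ∈ G, (x ^ 2 + (1 - x) * φ i) ≤ ∑ i ∈ G, g i := Finset.sum_le_sum fun i _ => hφsq i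
    have h2' : ∑ i ∈ G, (x ^ 2 + (1 - x) * φ i) = (n : ℝ) * x ^ 2 + (1 - x) * ∑ i ∈ G, φ i := by
      rw [Finset.sum_add_distrib, Finset.sum_const, ← Finset.mul_sum, hn]; simp
    have h3 : CG / b ≤ ∑ i ∈ G, φ i := by rw [div_le_iff₀ hbpos]; linarith
    have h4 : (1 - x) * CG / b ≤ (1 - x) * ∑ i ∈ G, φ i := by
      rw [mul_div_assoc]; exact mul_le_mul_of_nonneg_left h3 hy.le
    linarith
  have hAMGM : 0 < n → Q ≤ ((∑ i ∈ G, (1 - g i)) / n) ^ n := by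
    intro hn0
    have hne : G.Nonempty := Finset.card_pos.1 (hn ▸ hn0)
    have := Literature.Combinatorics.StablePolynomials.Gurvits.finset_prod_le_arith_mean_pow G (fun i => 1 - g i)
      (fun i _ => sub_nonneg.2 (hg i).2) hne
    rw [← hn] at this; exact this
  have hsum1g : ∑ i ∈ G, (1 - g i) = (n : ℝ) - ∑ i ∈ G, g i := by
    rw [Finset.sum_sub_distrib, Finset.sum_const, nsmul_eq_mul, mul_one, hn]
  have hmean_nonneg : 0 ≤ (∑ i ∈ G, (1 - g i)) / n :=
    div_nonneg (Finset.sum_nonneg fun i _ => sub_nonneg.2 (hg i).2) (Nat.cast_nonneg _)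
  have hQb1 : 0 < n → Q ≤ (1 - x ^ 2 - (1 - x) * CG / ((b : ℝ) * n)) ^ n := by
    intro hn0
    have hnpos : (0 : ℝ) < n := by exact_mod_cast hn0
    refine (hAMGM hn0).trans (pow_le_pow_left₀ hmean_nonneg ?_ n)
    rw [hsum1g, div_le_iff₀ hnpos]
    rcases hsum_g_lo2 with h | hb0
    · have hnne : (n : ℝ) ≠ 0 := ne_of_gt hnpos
      have e1 : (1 - x) * CG / ((b : ℝ) * n) * n = (1 - x) * CG / b := by
        rw [div_mul_eq_mul_div, mul_div_mul_right _ _ hnne]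
      have e : (1 - x ^ 2 - (1 - x) * CG / ((b : ℝ) * n)) * n = n - ((n : ℝ) * x ^ 2 + (1 - x) * CG / b) := by
        rw [sub_mul, sub_mul, one_mul, e1]; ring
      rw [e]; linarith
    · -- b = 0: then every size is 0 and the credit hypothesis is absurd
      exfalso
      have hall : ∀ i, a i = 0 := fun i => by have := hlargest i; rw [hb0] at this; omega
      have : ∑ i, (a i : ℝ) * φ i = 0 := Finset.sum_eq_zero fun i _ => by rw [hall i, Nat.cast_zero, zero_mul]
      rw [this] at hcredit
      have : (0 : ℝ) ≤ 2 * j := by positivity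
      linarith
  have hQb2 : 0 < n → Q ≤ (1 - mG / ((b : ℝ) * n)) ^ n := by
    intro hn0
    have hnpos : (0 : ℝ) < n := by exact_mod_cast hn0
    refine (hAMGM hn0).trans (pow_le_pow_left₀ hmean_nonneg ?_ n)
    rw [hsum1g, div_le_iff₀ hnpos]
    by_cases hb0 : (b : ℝ) = 0
    · have hmG0 : mG ≤ 0 := by rw [hb0, zero_mul] at hsum_g_lo1; exact hsum_g_lo1
      have hmG0' : 0 ≤ mG := hCG0.trans hCGm
      have hmGz : mG = 0 := le_antisymm hmG0 hmG0'
      have hfrac : mG / ((b : ℝ) * n) = 0 := by rw [hmGz, zero_div]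
      have hsg : 0 ≤ ∑ i ∈ G, g i := Finset.sum_nonneg fun i _ => (hg i).1
      rw [hfrac]; linarith
    · have hbpos : (0 : ℝ) < b := lt_of_le_of_ne (Nat.cast_nonneg _) (Ne.symm hb0)
      have hnne : (n : ℝ) ≠ 0 := ne_of_gt hnpos
      have e1 : mG / ((b : ℝ) * n) * n = mG / b := by rw [div_mul_eq_mul_div, mul_div_mul_right _ _ hnne]
      have e : (1 - mG / ((b : ℝ) * n)) * n = n - mG / b := by rw [sub_mul, one_mul, e1]
      rw [e]
      have : mG / b ≤ ∑ i ∈ G, g i := by rw [div_le_iff₀ hbpos]; linarith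
      linarith
  -- D vanishes when b = j
  have hADj : b = j → AD = 0 := by
    intro hbj
    refine Finset.sum_eq_zero fun i _ => ?_
    have := ha''le i; rw [hbj, Nat.sub_self] at this
    rw [Nat.le_zero.1 this, Nat.cast_zero]
  -- credit split
  have hcr : (2 * j : ℝ) < (b : ℝ) * φ k₀ + CG + CD := by
    have h1 : ∑ i, (a i : ℝ) * φ i = (a k₀ : ℝ) * φ k₀ + ∑ i ∈ Finset.univ.erase k₀, (a i : ℝ) * φ i :=
      (Finset.add_sum_erase _ _ (Finset.mem_univ k₀)).symm
    have h2 : ∑ i, (a' i : ℝ) * φ i = (a' k₀ : ℝ) * φ k₀ + ∑ i ∈ Finset.univ.erase k₀, (a' i : ℝ) * φ i :=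
      (Finset.add_sum_erase _ _ (Finset.mem_univ k₀)).symm
    have h3 : ∑ i ∈ Finset.univ.erase k₀, (a' i : ℝ) * φ i = ∑ i ∈ Finset.univ.erase k₀, (a i : ℝ) * φ i :=
      Finset.sum_congr rfl fun i hi => by rw [ha'ne i (Finset.ne_of_mem_erase hi)]
    rw [ha'k, Nat.cast_zero, zero_mul, zero_add, h3] at h2
    have hrest : ∑ i ∈ Finset.univ.erase k₀, (a i : ℝ) * φ i = CG + CD := by rw [← h2]; exact hC_split
    have hbk : ((b : ℕ) : ℝ) = (a k₀ : ℝ) := by rw [hb]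
    rw [hbk]
    have := hcredit
    rw [h1, hrest] at this
    linarith
  have hφk : φ k₀ = (if x ≤ g k₀ then g k₀ else (g k₀ - x ^ 2) / (1 - x)) := rfl
  rw [hφk] at hcr
  have hbj : (b : ℕ) ≤ j := hkj
  have hlumpy' : (j : ℝ) < 2 * x * (b : ℝ) := by rw [hb]; exact hlumpy
  -- apply the certificate
  obtain ⟨z₁, z₀, hz₁, hz₀, hxz⟩ := hC x (g k₀) Q AG mG CG s2G AD mD CD s2D j b n hx hx78 (hfloor k₀) (hg k₀).2 hbj hlumpy'
    hcr hAGlo hAGhi hCG0 hCGm hG2 hGmA hs2G0 hs2G1 hs2G2 hs2G3 hQ0 hQ1 hQn0 hQb1 hQb2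
    hCD0 hCDm hD2 hDmA hs2D0 hs2D1 hs2D2 hs2D3 hADj
  -- discharge `z₁ ≤ TERM[b, a', g, j]` (exact-∨ ⊗ Cantelli-dust) and `z₀ ≤ TERM[0, a', g, j]` (Markov / Cantelli)
  have hT1 : z₁ ≤ TERM[b, a', g, j] :=
    term_ge_of_or_cantelliDust b a' g j hg hkj G hG (fun i hi => by rw [← ha''nG i hi]; exact ha''le i) z₁ hz₁
  have hT0 : z₀ ≤ ∑ W : Finset κ, wt[g, W] * (if j + 1 ≤ ∑ i ∈ W, a' i then (1 : ℝ) else 0) := by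
    have goal_shape : TERM[0, a', g, j] = ∑ W : Finset κ, wt[g, W] * (if j + 1 ≤ ∑ i ∈ W, a' i then (1 : ℝ) else 0) :=
      Finset.sum_congr rfl fun W _ => by rw [zero_add]
    rw [← goal_shape]
    refine term_ge_of_restMenu a' g j hg ((b : ℝ) * s2G + ((j - b : ℕ) : ℝ) * s2D) hV_split z₀ ?_
    rw [hA_split, hm_split]
    exact hz₀
  have e1 := mul_le_mul_of_nonneg_left hT1 (hg k₀).1
  have e0 := mul_le_mul_of_nonneg_left hT0 (sub_nonneg.2 (hg k₀).2)
  linarith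

end RootDec

namespace IndepBlob

/-- **`COCert` ⟹ CONJECTURE DIB\* AT EVERY FLOOR `x < 1`.**  Floors `≤ 1/2` and `≥ 7/8` are kernel (`DIBStar.of_le_half`,
`dibStar_of_ge_seven_eighths`); on `(1/2, 7/8)`: junk lights zeroed, empty gates set to `1`, a giant of the normalised system is heavy
(`term_ge_disj_giants`), a largest blob with `2x·b ≤ j` makes the system granular (`tail_ge_of_granular`), and otherwise
`RootDec.row_of_coCert`. [this work] -/
theorem dibStar_of_coCert (hC : COCert) (x : ℝ) (hx1 : x < 1) : DIBStar x := by
  by_cases hmem : x ∈ Set.Ioo (1 / 2 : ℝ) (7 / 8)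
  swap
  · exact dibStar_of_not_mem_Ioo x hx1 hmem
  obtain ⟨hx, hx78⟩ := hmem
  intro ι _ _ a g j hg hlight hcredit
  have hx0 : 0 ≤ x := by linarith
  have hy : 0 < 1 - x := by linarith
  have hx2 : x ^ 2 ≤ x := by nlinarith
  set φ : ℝ → ℝ := fun t => if x ≤ t then t else (t - x ^ 2) / (1 - x) with hφ
  -- (1) zero out the junk
  set a₁ : ι → ℕ := fun k => if x ^ 2 ≤ g k then a k else 0 with ha₁
  have ha₁le : ∀ k, a₁ k ≤ a k := fun k => by simp only [ha₁]; split_ifs <;> omega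
  have ha₁eq : ∀ k, x ^ 2 ≤ g k → a₁ k = a k := fun k hk => by simp only [ha₁, if_pos hk]
  have ha₁zero : ∀ k, g k < x ^ 2 → a₁ k = 0 := fun k hk => by simp only [ha₁, if_neg (not_le.2 hk)]
  have hcredit₁ : (2 * j : ℝ) < ∑ k, (a₁ k : ℝ) * φ (g k) := by
    refine hcredit.trans_le (Finset.sum_le_sum fun k _ => ?_)
    by_cases hk : x ^ 2 ≤ g k
    · rw [ha₁eq k hk]
    · have hgk : g k < x ^ 2 := not_le.1 hk
      have hgx : ¬ x ≤ g k := not_le.2 (hgk.trans_le hx2)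
      rw [ha₁zero k hgk, Nat.cast_zero, zero_mul]
      have hneg : φ (g k) ≤ 0 := by
        simp only [hφ, if_neg hgx]
        exact div_nonpos_of_nonpos_of_nonneg (by linarith) hy.le
      exact mul_nonpos_of_nonneg_of_nonpos (Nat.cast_nonneg _) hneg
  -- (2) normalise the gates of empty blobs
  set g₁ : ι → ℝ := fun k => if a₁ k = 0 then 1 else g k with hg₁
  have hg₁eq : ∀ k, a₁ k ≠ 0 → g₁ k = g k := fun k hk => by simp only [hg₁, if_neg hk]
  have hg₁01 : ∀ k, 0 ≤ g₁ k ∧ g₁ k ≤ 1 := fun k => by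
    by_cases hk : a₁ k = 0
    · simp only [hg₁, if_pos hk]; norm_num
    · rw [hg₁eq k hk]; exact hg k
  have hfloor₁ : ∀ k, x ^ 2 ≤ g₁ k := fun k => by
    by_cases hk : a₁ k = 0
    · simp only [hg₁, if_pos hk]; nlinarith
    · rw [hg₁eq k hk]
      by_contra hcon
      exact hk (ha₁zero k (not_le.1 hcon))
  have hcredit₂ : (2 * j : ℝ) < ∑ k, (a₁ k : ℝ) * φ (g₁ k) := by
    refine hcredit₁.trans_le (le_of_eq (Finset.sum_congr rfl fun k _ => ?_))
    by_cases hk : a₁ k = 0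
    · rw [hk, Nat.cast_zero, zero_mul, zero_mul]
    · rw [hg₁eq k hk]
  have htail : ∑ W : Finset ι, (∏ k, if k ∈ W then g₁ k else 1 - g₁ k) * (if j + 1 ≤ ∑ k ∈ W, a₁ k then (1 : ℝ) else 0) ≤
      ∑ W : Finset ι, (∏ k, if k ∈ W then g k else 1 - g k) * (if j + 1 ≤ ∑ k ∈ W, a k then (1 : ℝ) else 0) := by
    rw [RootDec.dibSum_congr_offEmpty a₁ g g₁ j hg₁eq]
    have h := RootDec.term_mono_sizes 0 a₁ a g j hg ha₁le
    simpa only [zero_add] using h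
  refine le_trans ?_ htail
  -- (3) a largest blob of `a₁`
  have hne : (Finset.univ : Finset ι).Nonempty := by
    rcases (Finset.univ : Finset ι).eq_empty_or_nonempty with h | h
    · exfalso
      rw [h, Finset.sum_empty] at hcredit
      have : (0 : ℝ) ≤ 2 * j := by positivity
      linarith
    · exact h
  obtain ⟨k₀, -, hk₀⟩ := Finset.exists_max_image Finset.univ a₁ hne
  have hlargest : ∀ k, a₁ k ≤ a₁ k₀ := fun k => hk₀ k (Finset.mem_univ k)
  by_cases hgiant : j + 1 ≤ a₁ k₀
  · have hk₀ne : a₁ k₀ ≠ 0 := by omega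
    have hheavy : x ≤ g k₀ := by
      by_contra hcon
      have := hlight k₀ (not_le.1 hcon)
      have := ha₁le k₀
      omega
    have hgk₀ : g₁ k₀ = g k₀ := hg₁eq k₀ hk₀ne
    have h := RootDec.term_ge_disj_giants 0 a₁ g₁ j hg₁01 {k₀} (fun k hk => by
      rw [Finset.mem_singleton] at hk; rw [hk]; omega)
    rw [Finset.prod_singleton, hgk₀, sub_sub_cancel] at h
    exact hheavy.trans (h.trans (le_of_eq (Finset.sum_congr rfl fun W _ => by rw [zero_add])))
  have hkj : a₁ k₀ ≤ j := by omega
  by_cases hlumpy : (j : ℝ) < 2 * x * (a₁ k₀ : ℝ)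
  · exact RootDec.row_of_coCert hC a₁ g₁ j x hx hx78 hg₁01 hfloor₁ k₀ hlargest hkj hlumpy hcredit₂
  · -- granular: every size is at most `j/(2x)`
    refine tail_ge_of_granular x hx0 hx1 a₁ g₁ j hg₁01 (fun k => ?_) hcredit₂
    have h1 : (a₁ k : ℝ) ≤ (a₁ k₀ : ℝ) := by exact_mod_cast hlargest k
    nlinarith [not_lt.1 hlumpy]

/-- Hence the mid-floor step lemma (class of record) from `COCert`. [this work] -/
theorem stepLemmaFSMid_of_coCert (hC : COCert) : StepLemmaFSMid :=
  stepLemmaFSMid_of_dibStar (dibStar_of_coCert hC)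

end IndepBlob

end Quant

end Summit.CriticalPhenomena.PercolationContinuityZ3.Theorems
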